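import Mathlib
import Summits.ValiantsHypothesis.ValiantsHypothesis.Theorems.BarrierLeverPartitionMinorsHitByVPHiddenStatesTwoUnfedCoef

/-!
# Route BarrierLever — item `PartitionMinorsHitByVP` (stmt-ValiantsHypothesis-19717), line `hidden-states`:
# THE PEEL OPERATOR OF AN UNFED COORDINATE AND ITS ACTION ON TRANSFER COEFFICIENTS

Helper file (`--supports stmt-ValiantsHypothesis-19717`; cell valiant-natproofs, 𝒟-side door (c), registered line
`Cruxes/PartitionMinorsHitByVP/Lines/hidden_states.lean` v8; prover seat val-np-p6 gen 17).  Closes NO item.  Definition: `peelOp`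
(transparent).  Step two towards THEOREM 2U (memo HOME/val-np-p6/g17/MEMO-valnp6-g17.md §4).

For an unfed coordinate `q` (`w q q = 1`, `w a q = 0` for `a ≠ q`) the PEEL OPERATOR on functions of sets is
`(peelOp w q c) R = c R − Σ_{d ∈ R} w q d · c (R − d + q)`.  On transfer coefficients (for `q ∉ R`):
* `peelOp_coef_of_notMem` — `S ∌ q`: `peelOp q (coef S) R = coef S R`;
* ★ `peelOp_coef_insert` — `S = S' + q`: `peelOp q (coef S) R = (Σ_{d∈R} w q d) · coef S' R` (from `coef_insert_unfed`);
* for TWO unfed coordinates `q₁ ≠ q₂` with DISJOINT sources (`w q₁ d · w q₂ d = 0`), the double peel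
  `E = peelOp q₂ ∘ peelOp q₁` evaluated at a `q`-free `R` sends `coef S` to `s₁^{[q₁∈S]} s₂^{[q₂∈S]} · coef (S ∖ {q₁,q₂}) R`
  (`doublePeel_coef_free`, `_coef_one`, `_coef_two`, ★ `doublePeel_coef_both`) — in particular to `0` whenever `|S ∖ {q₁,q₂}| < |R|`.

WHAT THIS IS NOT: the determinant consequence (THEOREM 2U) is the sequel `…TwoUnfed`; nothing on crux 14610 or VP ≠ VNP.
-/

set_option linter.dupNamespace false

namespace Summit.ValiantsHypothesis.ValiantsHypothesis.Theorems.BarrierLever.HiddenStates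

open Finset

noncomputable section

namespace SecondShell

variable {ι : Type} [Fintype ι] [DecidableEq ι]

/-- the peel operator of the coordinate `q`. -/
def peelOp (w : ι → ι → ℂ) (q : ι) (c : Finset ι → ℂ) (R : Finset ι) : ℂ :=
  c R - ∑ d ∈ R, w q d * c (insert q (R.erase d))

omit [Fintype ι] in
/-- the peel operator only reads `c` at `R` and at the sets `R − d + q`. -/
theorem peelOp_congr (w : ι → ι → ℂ) (q : ι) {c c' : Finset ι → ℂ} {R : Finset ι} (h0 : c R = c' R)
    (h1 : ∀ d ∈ R, c (insert q (R.erase d)) = c' (insert q (R.erase d))) : peelOp w q c R = peelOp w q c' R := by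
  simp only [peelOp, h0]
  congr 1
  exact Finset.sum_congr rfl fun d hd => by rw [h1 d hd]

/-- peeling a coordinate absent from `S` does nothing (at `q ∉ R`). -/
theorem peelOp_coef_of_notMem (w : ι → ι → ℂ) {q : ι} (hcol : ∀ a, a ≠ q → w a q = 0) {S R : Finset ι} (hqS : q ∉ S) :
    peelOp w q (coef w S) R = coef w S R := by
  simp only [peelOp]
  have h0 : ∑ d ∈ R, w q d * coef w S (insert q (R.erase d)) = 0 := by
    refine Finset.sum_eq_zero fun d _ => ?_
    rw [coef_eq_zero_of_unfed_mem w hcol hqS (Finset.mem_insert_self q _), mul_zero]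
  rw [h0, sub_zero]

/-- ★ peeling the top coordinate of `S' + q`: `peelOp q (coef (S'+q)) X = (Σ_{d∈X} w q d)·coef S' X` for `q ∉ X`. -/
theorem peelOp_coef_insert (w : ι → ι → ℂ) {q : ι} (hcol : ∀ a, a ≠ q → w a q = 0) (hqq : w q q = 1)
    {S' X : Finset ι} (hqS : q ∉ S') (hqX : q ∉ X) :
    peelOp w q (coef w (insert q S')) X = (∑ d ∈ X, w q d) * coef w S' X := by
  have hY : ∀ d ∈ X, coef w (insert q S') (insert q (X.erase d)) = coef w S' (X.erase d) := by
    intro d hd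
    rw [coef_insert_unfed w hcol hqq hqS, if_pos (Finset.mem_insert_self q _)]
    have he : (insert q (X.erase d)).erase q = X.erase d :=
      Finset.erase_insert (fun h => hqX (Finset.mem_of_mem_erase h))
    rw [he, Finset.sum_eq_zero, add_zero]
    intro d' hd'
    have hd'q : d' ≠ q := fun h => hqX (Finset.mem_of_mem_erase (h ▸ hd'))
    rw [coef_eq_zero_of_unfed_mem w hcol hqS (Finset.mem_insert_self q _),
      coef_eq_zero_of_unfed_mem w hcol hqS (Finset.mem_erase.2 ⟨Ne.symm hd'q, Finset.mem_insert_self q _⟩)]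
    ring
  have h2 : ∑ d ∈ X, w q d * coef w (insert q S') (insert q (X.erase d)) = ∑ d ∈ X, w q d * coef w S' (X.erase d) :=
    Finset.sum_congr rfl fun d hd => by rw [hY d hd]
  have h1 : coef w (insert q S') X = ∑ d ∈ X, w q d * (coef w S' X + coef w S' (X.erase d)) := by
    rw [coef_insert_unfed w hcol hqq hqS X, if_neg hqX, zero_add, Finset.erase_eq_of_notMem hqX]
  simp only [peelOp]
  rw [h2, h1]
  have h3 : ∑ d ∈ X, w q d * (coef w S' X + coef w S' (X.erase d)) =
      (∑ d ∈ X, w q d) * coef w S' X + ∑ d ∈ X, w q d * coef w S' (X.erase d) := by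
    rw [Finset.sum_mul, ← Finset.sum_add_distrib]; exact Finset.sum_congr rfl fun d _ => by ring
  rw [h3]; ring

/-! ## The double peel of two unfed coordinates with disjoint sources -/

section Double

variable (w : ι → ι → ℂ) {q₁ q₂ : ι} (hne : q₁ ≠ q₂)
  (hcol₁ : ∀ a, a ≠ q₁ → w a q₁ = 0) (hcol₂ : ∀ a, a ≠ q₂ → w a q₂ = 0) (hq₁ : w q₁ q₁ = 1) (hq₂ : w q₂ q₂ = 1)

include hne in
omit [Fintype ι] in
/-- `q`-free `R`: `R − d + q₂` avoids `q₁`. -/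
theorem notMem_insert_erase {R : Finset ι} (h₁ : q₁ ∉ R) (d : ι) : q₁ ∉ insert q₂ (R.erase d) := by
  rw [Finset.mem_insert, not_or]
  exact ⟨hne, fun h => h₁ (Finset.mem_of_mem_erase h)⟩

include hcol₁ hcol₂ in
/-- (E0) both coordinates absent. -/
theorem doublePeel_coef_free {S R : Finset ι} (h₁S : q₁ ∉ S) (h₂S : q₂ ∉ S) :
    peelOp w q₂ (peelOp w q₁ (coef w S)) R = coef w S R := by
  rw [peelOp_congr w q₂ (c' := coef w S) (peelOp_coef_of_notMem w hcol₁ h₁S)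
    (fun d _ => peelOp_coef_of_notMem w hcol₁ h₁S)]
  exact peelOp_coef_of_notMem w hcol₂ h₂S

include hcol₁ hcol₂ hne hq₁ in
/-- (E1) `S = S' + q₁`, `S'` free of both: the double peel gives `s₁(R)·coef S' R`. -/
theorem doublePeel_coef_one {S' R : Finset ι} (h₁S : q₁ ∉ S') (h₂S : q₂ ∉ S') (h₁R : q₁ ∉ R) :
    peelOp w q₂ (peelOp w q₁ (coef w (insert q₁ S'))) R = (∑ d ∈ R, w q₁ d) * coef w S' R := by
  rw [peelOp_congr w q₂ (c' := fun Y => (∑ d ∈ Y, w q₁ d) * coef w S' Y)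
    (peelOp_coef_insert w hcol₁ hq₁ h₁S h₁R)
    (fun d _ => peelOp_coef_insert w hcol₁ hq₁ h₁S (notMem_insert_erase hne h₁R d))]
  simp only [peelOp]
  have h0 : ∑ d ∈ R, w q₂ d * ((∑ x ∈ insert q₂ (R.erase d), w q₁ x) * coef w S' (insert q₂ (R.erase d))) = 0 := by
    refine Finset.sum_eq_zero fun d _ => ?_
    rw [coef_eq_zero_of_unfed_mem w hcol₂ h₂S (Finset.mem_insert_self q₂ _)]; ring
  rw [h0, sub_zero]

include hcol₁ hcol₂ hne hq₂ in
/-- (E2) `S = S' + q₂`, `S'` free of both: the double peel gives `s₂(R)·coef S' R`. -/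
theorem doublePeel_coef_two {S' R : Finset ι} (h₁S : q₁ ∉ S') (h₂S : q₂ ∉ S') (h₂R : q₂ ∉ R) :
    peelOp w q₂ (peelOp w q₁ (coef w (insert q₂ S'))) R = (∑ d ∈ R, w q₂ d) * coef w S' R := by
  have h₁S2 : q₁ ∉ insert q₂ S' := by rw [Finset.mem_insert, not_or]; exact ⟨hne, h₁S⟩
  rw [peelOp_congr w q₂ (c' := coef w (insert q₂ S')) (peelOp_coef_of_notMem w hcol₁ h₁S2)
    (fun d _ => peelOp_coef_of_notMem w hcol₁ h₁S2)]
  exact peelOp_coef_insert w hcol₂ hq₂ h₂S h₂R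

include hcol₁ hcol₂ hne hq₁ hq₂ in
/-- ★ (E3) `S = S'' + q₁ + q₂`, `S''` free of both, DISJOINT sources: the double peel gives `s₁(R) s₂(R)·coef S'' R`. -/
theorem doublePeel_coef_both (hdisj : ∀ d, d ≠ q₁ → d ≠ q₂ → w q₁ d * w q₂ d = 0)
    {S'' R : Finset ι} (h₁S : q₁ ∉ S'') (h₂S : q₂ ∉ S'') (h₁R : q₁ ∉ R) (h₂R : q₂ ∉ R) :
    peelOp w q₂ (peelOp w q₁ (coef w (insert q₁ (insert q₂ S'')))) R =
      (∑ d ∈ R, w q₁ d) * (∑ d ∈ R, w q₂ d) * coef w S'' R := by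
  have h₁S2 : q₁ ∉ insert q₂ S'' := by rw [Finset.mem_insert, not_or]; exact ⟨hne, h₁S⟩
  rw [peelOp_congr w q₂ (c' := fun Y => (∑ d ∈ Y, w q₁ d) * coef w (insert q₂ S'') Y)
    (peelOp_coef_insert w hcol₁ hq₁ h₁S2 h₁R)
    (fun d _ => peelOp_coef_insert w hcol₁ hq₁ h₁S2 (notMem_insert_erase hne h₁R d))]
  -- the values of `coef (S''+q₂)` at `R` and at `R − d + q₂`
  have hY : ∀ d ∈ R, coef w (insert q₂ S'') (insert q₂ (R.erase d)) = coef w S'' (R.erase d) := by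
    intro d hd
    rw [coef_insert_unfed w hcol₂ hq₂ h₂S, if_pos (Finset.mem_insert_self q₂ _)]
    have he : (insert q₂ (R.erase d)).erase q₂ = R.erase d :=
      Finset.erase_insert (fun h => h₂R (Finset.mem_of_mem_erase h))
    rw [he, Finset.sum_eq_zero, add_zero]
    intro d' hd'
    have hd'q : d' ≠ q₂ := fun h => h₂R (Finset.mem_of_mem_erase (h ▸ hd'))
    rw [coef_eq_zero_of_unfed_mem w hcol₂ h₂S (Finset.mem_insert_self q₂ _),
      coef_eq_zero_of_unfed_mem w hcol₂ h₂S (Finset.mem_erase.2 ⟨Ne.symm hd'q, Finset.mem_insert_self q₂ _⟩)]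
    ring
  have hs : ∀ d ∈ R, ∑ x ∈ insert q₂ (R.erase d), w q₁ x = (∑ x ∈ R, w q₁ x) - w q₁ d := by
    intro d hd
    rw [Finset.sum_insert (fun h => h₂R (Finset.mem_of_mem_erase h)), hcol₂ q₁ hne, zero_add,
      Finset.sum_erase_eq_sub hd]
  have h1 : coef w (insert q₂ S'') R = ∑ d ∈ R, w q₂ d * (coef w S'' R + coef w S'' (R.erase d)) := by
    rw [coef_insert_unfed w hcol₂ hq₂ h₂S R, if_neg h₂R, zero_add, Finset.erase_eq_of_notMem h₂R]
  have h2 : ∑ d ∈ R, w q₂ d * ((∑ x ∈ insert q₂ (R.erase d), w q₁ x) * coef w (insert q₂ S'') (insert q₂ (R.erase d))) =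
      ∑ d ∈ R, w q₂ d * (((∑ x ∈ R, w q₁ x) - w q₁ d) * coef w S'' (R.erase d)) :=
    Finset.sum_congr rfl fun d hd => by rw [hY d hd, hs d hd]
  have hdiag : ∑ d ∈ R, w q₂ d * (w q₁ d * coef w S'' (R.erase d)) = 0 := by
    refine Finset.sum_eq_zero fun d hd => ?_
    have e1 : d ≠ q₁ := fun h => h₁R (h ▸ hd)
    have e2 : d ≠ q₂ := fun h => h₂R (h ▸ hd)
    calc w q₂ d * (w q₁ d * coef w S'' (R.erase d)) = (w q₁ d * w q₂ d) * coef w S'' (R.erase d) := by ring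
      _ = 0 := by rw [hdisj d e1 e2, zero_mul]
  simp only [peelOp]
  rw [h2, h1]
  -- pure algebra now
  have e3 : ∑ d ∈ R, w q₂ d * (((∑ x ∈ R, w q₁ x) - w q₁ d) * coef w S'' (R.erase d)) =
      (∑ x ∈ R, w q₁ x) * ∑ d ∈ R, w q₂ d * coef w S'' (R.erase d) -
        ∑ d ∈ R, w q₂ d * (w q₁ d * coef w S'' (R.erase d)) := by
    rw [Finset.mul_sum, ← Finset.sum_sub_distrib]; exact Finset.sum_congr rfl fun d _ => by ring
  have e4 : ∑ d ∈ R, w q₂ d * (coef w S'' R + coef w S'' (R.erase d)) =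
      (∑ d ∈ R, w q₂ d) * coef w S'' R + ∑ d ∈ R, w q₂ d * coef w S'' (R.erase d) := by
    rw [Finset.sum_mul, ← Finset.sum_add_distrib]; exact Finset.sum_congr rfl fun d _ => by ring
  rw [e3, hdiag, sub_zero, e4]; ring

end Double

end SecondShell

end

end Summit.ValiantsHypothesis.ValiantsHypothesis.Theorems.BarrierLever.HiddenStates
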